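import Mathlib
import Summits.MatrixMultiplication.MatrixMultiplication.Theorems.LieRankDesigns.Negative.Basics
import Literature.RepresentationTheory.FiniteGroups.InducedRecognition

/-!
# `LieRankDesigns` (stmt-MatrixMultiplication-7614), line `Sketch`: stub I `stub_sharpLevelDegree` — the sharp level degree bound

Crux `Summit.MatrixMultiplication.MatrixMultiplication.Theses.LevelGradedCohnUmans.LieRankDesigns`; skeleton
`Cruxes/LieRankDesigns/Lines/Sketch.lean` (lead prover-line-stmt-MatrixMultiplication-7614-0); this file proves
the registered stub `stub_sharpLevelDegree` verbatim and lands `--supports stmt-MatrixMultiplication-7614`.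

Content. `G = GL_m(𝔽_p)`, `1 ≤ k ≤ m`, `χ = χ_ρ ∈ Irr(G) ∩ F_k`, `H = H_k` the frame stabiliser (first `k`
columns those of `1`).  `V^H ≠ 0` (stub A's argument, re-proved: `invariants_ne_bot`) is stable under the
block-diagonal copy `s(GL_k(𝔽_p)) = [[*,0],[0,1]]` (it normalises `H`), so contains an irreducible `GL_k`-piece `W`,
`dim W ≤ 2^k p^{k(k-1)/2}` by the hypothesis (Green); `W` is stable under the subgroup `P ⊇ s(GL_k) H` of the `g`
with `ρ(g) W ⊆ W`, so `dim V ≤ [G:P] dim W` (`V` is a quotient of `Ind_P^G W`: tree `exists_indV_lift`,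
`finrank_indV_le`) and `[G:P] ≤ [G:H]/|GL_k(𝔽_p)| ≤ 2^k p^{k(m-k)}`: `dim V ≤ 2^{2k} p^{mk-k²/2-k/2}`, `2k ≤ m+k`.
Helpers shared with the sibling stub files `…Theorems.LevelGradedCohnUmansLieRankDesignsStub{LevelFixedVector,
ParabolicFacts}` (stubs A, B) are re-derived in the sub-namespace `SharpLevelDegree` (variant forms) rather than
imported, those modules not being built on the farm when this file was checked.
-/

set_option linter.dupNamespace false

noncomputable section

open scoped BigOperators
open Literature.RepresentationTheory.FiniteGroups
open Summit.MatrixMultiplication.MatrixMultiplication.Theorems.LieRankDesigns.Negative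
  (GLm Mat fourierFn RankSupp RankSep levelSet budget volume)

namespace Summit.MatrixMultiplication.MatrixMultiplication.Theorems.LieRankDesigns

namespace SharpLevelDegree

open Module

-- `exists_subgroup_of_mul_mem`, `card_pow_sq_le_card_GL`: adapted from
-- Summits/MatrixMultiplication/MatrixMultiplication/Theorems/LevelGradedCohnUmansLieRankDesignsStubParabolicFacts.lean
/-- In a finite group a property of `1` preserved under products cuts out a subgroup. [folklore] -/
theorem exists_subgroup_of_mul_mem {G : Type*} [Group G] [Finite G] (S : G → Prop) (h1 : S 1)
    (hmul : ∀ a b, S a → S b → S (a * b)) : ∃ K : Subgroup G, ∀ g, g ∈ K ↔ S g := by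
  let M : Submonoid G := { carrier := {g | S g}, one_mem' := h1, mul_mem' := fun ha hb => hmul _ _ ha hb }
  refine ⟨{ M with inv_mem' := fun {a} ha => ?_ }, fun g => Iff.rfl⟩
  change a⁻¹ ∈ M
  rw [← one_mul a⁻¹, ← pow_one a, ← pow_orderOf_eq_one a, ← pow_sub a (orderOf_pos a)]
  exact M.pow_mem ha (orderOf a - 1)

/-- `q^{k²} ≤ 2^k · |GL_k(𝔽_q)|`: each factor of `|GL_k(𝔽_q)| = Π_{i<k} (q^k - q^i)` is `≥ q^k / 2`. [folklore] -/
theorem card_pow_sq_le_card_GL (K : Type*) [Field K] [Fintype K] (k : ℕ) :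
    Fintype.card K ^ (k * k) ≤ 2 ^ k * Nat.card (GL (Fin k) K) := by
  have hq : 2 ≤ Fintype.card K := Fintype.one_lt_card
  rw [Matrix.card_GL_field]
  calc Fintype.card K ^ (k * k) = ∏ _i : Fin k, Fintype.card K ^ k := by
        rw [Finset.prod_const, Finset.card_univ, Fintype.card_fin, ← pow_mul]
    _ ≤ ∏ i : Fin k, 2 * (Fintype.card K ^ k - Fintype.card K ^ (i : ℕ)) := by
        refine Finset.prod_le_prod (fun i _ => Nat.zero_le _) fun i _ => ?_
        have h1 : Fintype.card K ^ (i : ℕ) * 2 ≤ Fintype.card K ^ (i : ℕ) * Fintype.card K ^ (k - i) :=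
          Nat.mul_le_mul_left _ (le_trans hq (Nat.le_self_pow (by have := i.isLt; omega) _))
        rw [← pow_add, Nat.add_sub_cancel' i.isLt.le] at h1
        omega
    _ = 2 ^ k * ∏ i : Fin k, (Fintype.card K ^ k - Fintype.card K ^ (i : ℕ)) := by
        rw [Finset.prod_mul_distrib, Finset.prod_const, Finset.card_univ, Fintype.card_fin]

/-- **Orbit-span bound** `dim V ≤ [G:P] · dim W` for an irreducible `ρ` and a non-zero `ρ(P)`-stable subspace
`W`: the `G`-map `Ind_P^G W → V` extending `W ↪ V` (tree `exists_indV_lift`) is onto by irreducibility, and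
`dim Ind_P^G W ≤ [G:P] dim W` (tree `finrank_indV_le`). [folklore] -/
theorem finrank_le_index_mul {G : Type} [Group G] [Finite G] {V : Type} [AddCommGroup V] [Module ℂ V]
    [FiniteDimensional ℂ V] (ρ : Representation ℂ G V) (hρ : ρ.IsIrreducible) (P : Subgroup G)
    (W : Submodule ℂ V) (hW : W ≠ ⊥) (hPW : ∀ g ∈ P, ∀ w ∈ W, ρ g w ∈ W) :
    finrank ℂ V ≤ P.index * finrank ℂ W := by
  let SW : Subrepresentation (ρ.comp P.subtype) := ⟨W, fun g w hw => hPW g g.2 w hw⟩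
  obtain ⟨F, hF1, hF⟩ := exists_indV_lift P.subtype SW.toRepresentation ρ W.subtype
    fun g => LinearMap.ext fun w => rfl
  obtain ⟨hfin, hle⟩ := finrank_indV_le (k := ℂ) P.subtype SW.toRepresentation
  let R : Subrepresentation ρ := ⟨LinearMap.range F, fun g v hv => by
    obtain ⟨x, rfl⟩ := hv
    exact ⟨Representation.ind P.subtype SW.toRepresentation g x, LinearMap.congr_fun (hF g) x⟩⟩
  have hRtop : LinearMap.range F = ⊤ := by
    haveI := hρ
    refine congrArg Subrepresentation.toSubmodule
      ((IsSimpleOrder.eq_bot_or_eq_top R).resolve_left fun hbot => hW (eq_bot_iff.mpr fun w hw => ?_))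
    have hR : LinearMap.range F = ⊥ := congrArg Subrepresentation.toSubmodule hbot
    have hFw : F (Representation.IndV.mk P.subtype SW.toRepresentation 1 ⟨w, hw⟩) = w := by
      rw [hF1, inv_one, map_one, Module.End.one_apply]; rfl
    have hmem := LinearMap.mem_range_self F (Representation.IndV.mk P.subtype SW.toRepresentation 1 ⟨w, hw⟩)
    rwa [hFw, hR] at hmem
  calc finrank ℂ V = finrank ℂ (LinearMap.range F) := by rw [hRtop, finrank_top]
    _ ≤ finrank ℂ (Representation.IndV P.subtype SW.toRepresentation) := LinearMap.finrank_range_le F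
    _ ≤ P.subtype.range.index * finrank ℂ W := hle
    _ = P.index * finrank ℂ W := by rw [Subgroup.range_subtype]

-- adapted from Summits/MatrixMultiplication/MatrixMultiplication/Theorems/LevelGradedCohnUmansLieRankDesignsStubLevelFixedVector.lean
/-- If `ρ|_H` has no invariant vectors then the averaging operator `Σ_{h ∈ H} ρ(h)` (with `H`-invariant values)
vanishes, and with it every translate `Σ_{h ∈ H} χ_ρ(h x) = tr((Σ_h ρ h) ρ x)`. [folklore] -/
theorem sum_char_mul_eq_zero {G V : Type} [Group G] [AddCommGroup V] [Module ℂ V]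
    (ρ : Representation ℂ G V) (H : Subgroup G) [Fintype H]
    (hbot : Representation.invariants (ρ.comp H.subtype) = ⊥) (x : G) : ∑ h : H, ρ.character (h * x) = 0 := by
  have hA : (∑ h : H, ρ h) = 0 := by
    ext v
    have hmem : (∑ h : H, ρ h) v ∈ Representation.invariants (ρ.comp H.subtype) := by
      rw [Representation.mem_invariants]
      intro g
      rw [LinearMap.sum_apply, map_sum]
      change ∑ h : H, ρ (g : G) (ρ (h : G) v) = ∑ h : H, ρ (h : G) v
      simp_rw [← Module.End.mul_apply, ← map_mul, ← Subgroup.coe_mul]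
      exact Fintype.sum_equiv (Equiv.mulLeft g) _ _ fun h => rfl
    rw [hbot, Submodule.mem_bot] at hmem; rw [hmem, LinearMap.zero_apply]
  calc ∑ h : H, ρ.character (h * x) = LinearMap.trace ℂ V ((∑ h : H, ρ h) * ρ x) := by
        simp only [Representation.character, map_mul, Finset.sum_mul, map_sum]
    _ = 0 := by rw [hA, zero_mul, map_zero]

variable {p m : ℕ}

/-- If the first `k` columns of `y` are those of `1`, then `x y` and `x` share their first `k` columns. [folklore] -/
theorem mul_apply_of_frame {k : ℕ} {x y : Mat p m}
    (hy : ∀ i j : Fin m, (i : ℕ) < k → y j i = (1 : Mat p m) j i) (i j : Fin m) (hi : (i : ℕ) < k) :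
    (x * y) j i = x j i := by
  conv_rhs => rw [← Matrix.mul_one x]
  simp only [Matrix.mul_apply]
  exact Finset.sum_congr rfl fun l _ => by rw [hy i l hi]

/-- If column `i` of `c` vanishes below row `k` and the rows `j` of `x`, `y` agree before column `k`, then
`(x c)_{ji} = (y c)_{ji}`. [folklore] -/
theorem mul_apply_congr {k : ℕ} {x y c : Mat p m} {i j : Fin m}
    (hc : ∀ l : Fin m, k ≤ (l : ℕ) → c l i = 0) (hxy : ∀ l : Fin m, (l : ℕ) < k → x j l = y j l) :
    (x * c) j i = (y * c) j i := by
  simp only [Matrix.mul_apply]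
  refine Finset.sum_congr rfl fun l _ => ?_
  by_cases hl : (l : ℕ) < k
  · rw [hxy l hl]
  · rw [hc l (not_lt.mp hl), mul_zero, mul_zero]

/-- **The block-diagonal copy of `GL_k(𝔽_p)`**: `A ↦ [[A, 0], [0, 1]]` (`k ≤ m`) is a group homomorphism
`GL_k(𝔽_p) → GL_m(𝔽_p)` whose values have vanishing lower-left block and upper-left block `A`. [folklore] -/
-- block coordinates adapted from `ParabolicFacts.exists_blockDiag` (…Theorems.LevelGradedCohnUmansLieRankDesignsStubParabolicFacts)
theorem exists_blockDiagHom [Fact p.Prime] {k : ℕ} (hkm : k ≤ m) :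
    ∃ s : GL (Fin k) (ZMod p) →* GLm p m, ∀ A : GL (Fin k) (ZMod p),
      (∀ i j : Fin m, (i : ℕ) < k → k ≤ (j : ℕ) → (s A : Mat p m) j i = 0) ∧
      ∀ x y : Fin k, (s A : Mat p m) (Fin.castLE hkm x) (Fin.castLE hkm y) =
        (A : Matrix (Fin k) (Fin k) (ZMod p)) x y := by
  have hkn : k + (m - k) = m := Nat.add_sub_cancel' hkm
  set e : Fin k ⊕ Fin (m - k) ≃ Fin m := finSumFinEquiv.trans (finCongr hkn) with he
  have he1 : ∀ (i : Fin m) (hi : (i : ℕ) < k), e.symm i = Sum.inl ⟨i, hi⟩ := fun i hi => by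
    rw [Equiv.symm_apply_eq, he]; exact Fin.ext rfl
  have he2 : ∀ (j : Fin m), k ≤ (j : ℕ) → ∃ z : Fin (m - k), e.symm j = Sum.inr z := fun j hj =>
    ⟨⟨j - k, by omega⟩, by rw [Equiv.symm_apply_eq, he]; exact Fin.ext (by change (j : ℕ) = k + (j - k); omega)⟩
  let f : Matrix (Fin k) (Fin k) (ZMod p) →* Mat p m :=
    { toFun := fun A => Matrix.reindex e e (Matrix.fromBlocks A 0 0 1)
      map_one' := by rw [Matrix.fromBlocks_one, Matrix.reindex_apply, Matrix.submatrix_one_equiv]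
      map_mul' := fun A B => by
        simp only [Matrix.reindex_apply, Matrix.submatrix_mul_equiv, Matrix.fromBlocks_multiply,
          Matrix.mul_zero, Matrix.zero_mul, add_zero, zero_add, Matrix.mul_one] }
  refine ⟨Units.map f, fun A => ?_⟩
  have hfA : ((Units.map f A : GLm p m) : Mat p m) = Matrix.reindex e e (Matrix.fromBlocks A 0 0 1) := rfl
  refine ⟨fun i j hi hj => ?_, fun x y => ?_⟩
  · obtain ⟨z, hz⟩ := he2 j hj
    rw [hfA, Matrix.reindex_apply, Matrix.submatrix_apply, hz, he1 i hi, Matrix.fromBlocks_apply₂₁]; rfl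
  · rw [hfA, Matrix.reindex_apply, Matrix.submatrix_apply, he1 _ x.isLt, he1 _ y.isLt,
      Matrix.fromBlocks_apply₁₁]
    rfl

-- the next four declarations are adapted from
-- Summits/MatrixMultiplication/MatrixMultiplication/Theorems/LevelGradedCohnUmansLieRankDesignsStubLevelFixedVector.lean
/-- A subspace is moved by some linear automorphism onto any subspace of the same dimension. [folklore] -/
theorem exists_linearEquiv_map_eq {K V : Type*} [Field K] [AddCommGroup V] [Module K V]
    [FiniteDimensional K V] (W E : Submodule K V) (h : finrank K W = finrank K E) :
    ∃ φ : V ≃ₗ[K] V, W.map (φ : V →ₗ[K] V) = E := by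
  obtain ⟨Wc, hWc⟩ := W.exists_isCompl
  obtain ⟨Ec, hEc⟩ := E.exists_isCompl
  have hc : finrank K Wc = finrank K Ec := by
    have := Submodule.finrank_add_eq_of_isCompl hWc; have := Submodule.finrank_add_eq_of_isCompl hEc; omega
  let e₁ : W ≃ₗ[K] E := LinearEquiv.ofFinrankEq W E h
  let e₂ : Wc ≃ₗ[K] Ec := LinearEquiv.ofFinrankEq Wc Ec hc
  refine ⟨(W.prodEquivOfIsCompl Wc hWc).symm ≪≫ₗ (e₁.prodCongr e₂) ≪≫ₗ (E.prodEquivOfIsCompl Ec hEc),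
    Submodule.eq_of_le_of_finrank_eq (Submodule.map_le_iff_le_comap.mpr fun w hw => ?_)
      (by rw [LinearEquiv.finrank_map_eq, h])⟩
  rw [Submodule.mem_comap, LinearEquiv.coe_coe]
  have hsymm : (W.prodEquivOfIsCompl Wc hWc).symm w = (⟨w, hw⟩, 0) :=
    Submodule.prodEquivOfIsCompl_symm_apply_left (p := W) (q := Wc) hWc ⟨w, hw⟩
  simp only [LinearEquiv.trans_apply, hsymm, LinearEquiv.prodCongr_apply, map_zero,
    Submodule.coe_prodEquivOfIsCompl', Submodule.coe_zero, add_zero]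
  exact (e₁ ⟨w, hw⟩).2

/-- For `rk M ≤ k` some `b ∈ GL_m(𝔽_p)` kills the rows `≥ k` of `b M` (a linear automorphism moving the column
space of `M` into the span of the first `rk M` standard basis vectors). [folklore] -/
theorem exists_mul_rows_eq_zero [Fact p.Prime] {k : ℕ} (M : Mat p m) (hM : M.rank ≤ k) :
    ∃ b : GLm p m, ∀ l : Fin m, k ≤ (l : ℕ) → ((b : Mat p m) * M) l = 0 := by
  have hrm : M.rank ≤ m := M.rank_le_width
  let v : Fin M.rank → (Fin m → ZMod p) := fun i => Pi.single (Fin.castLE hrm i) 1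
  have hv : LinearIndependent (ZMod p) v :=
    (Pi.linearIndependent_single_one (Fin m) (ZMod p)).comp (Fin.castLE hrm) (Fin.castLE_injective hrm)
  let E : Submodule (ZMod p) (Fin m → ZMod p) := Submodule.span (ZMod p) (Set.range v)
  have hE : finrank (ZMod p) E = M.rank := by rw [finrank_span_eq_card hv, Fintype.card_fin]
  obtain ⟨φ, hφ⟩ := exists_linearEquiv_map_eq (LinearMap.range M.mulVecLin) E
    (show finrank (ZMod p) (LinearMap.range M.mulVecLin) = finrank (ZMod p) E from hE.symm)
  have hEk : ∀ w ∈ E, ∀ l : Fin m, k ≤ (l : ℕ) → w l = 0 := by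
    intro w hw l hl
    induction hw using Submodule.span_induction with
    | mem x hx =>
      obtain ⟨i, rfl⟩ := hx
      exact Pi.single_eq_of_ne (fun h => by rw [h, Fin.val_castLE] at hl; have := i.isLt; omega) 1
    | zero => rfl
    | add x y _ _ hx hy => rw [Pi.add_apply, hx, hy, add_zero]
    | smul a x _ hx => rw [Pi.smul_apply, hx, smul_zero]
  have hmul : LinearMap.toMatrix' (φ : (Fin m → ZMod p) →ₗ[ZMod p] (Fin m → ZMod p)) *
      LinearMap.toMatrix' (φ.symm : (Fin m → ZMod p) →ₗ[ZMod p] (Fin m → ZMod p)) = 1 := by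
    rw [← LinearMap.toMatrix'_comp, LinearEquiv.comp_symm, LinearMap.toMatrix'_id]
  have hunit : IsUnit (LinearMap.toMatrix' (φ : (Fin m → ZMod p) →ₗ[ZMod p] (Fin m → ZMod p))) :=
    (Matrix.isUnit_iff_isUnit_det _).mpr (Matrix.isUnit_det_of_right_inverse hmul)
  refine ⟨hunit.unit, fun l hl => funext fun j => ?_⟩
  rw [hunit.unit_spec, Pi.zero_apply]
  have hcol : (LinearMap.toMatrix' (φ : (Fin m → ZMod p) →ₗ[ZMod p] (Fin m → ZMod p)) * M) l j =
      (φ : (Fin m → ZMod p) →ₗ[ZMod p] (Fin m → ZMod p)) (M.mulVec (Pi.single j 1)) l := by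
    rw [← LinearMap.toMatrix'_mulVec, Matrix.mulVec_mulVec, Matrix.mulVec_single_one]
    rfl
  exact hcol ▸ hEk _ (hφ.le (Submodule.mem_map_of_mem (LinearMap.mem_range_self M.mulVecLin (Pi.single j 1)))) l hl

/-- A Fourier mode is orthogonal to `χ` once all `H`-translates of `χ` vanish (`H` inside the frame stabiliser):
for `b` with the rows `≥ k` of `b M` zero, `f_M(g) = ψ(tr(M g))` is right-invariant under `b⁻¹ H b`, and
averaging over `H` gives `|H| · Σ_g f_M(g) χ(g⁻¹) = Σ_g f_M(g) Σ_{h ∈ H} χ(h · b g⁻¹ b⁻¹) = 0`. [folklore] -/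
theorem mode_sum_eq_zero [Fact p.Prime] {k : ℕ} (χ : GLm p m → ℂ)
    (hcl : ∀ x y : GLm p m, χ (x * y) = χ (y * x)) (H : Subgroup (GLm p m)) [Fintype H]
    (hHk : ∀ h ∈ H, ∀ i j : Fin m, (i : ℕ) < k → (h : Mat p m) j i = (1 : Mat p m) j i)
    (hH : ∀ x : GLm p m, ∑ h : H, χ (h * x) = 0) {M : Mat p m} {b : GLm p m}
    (hb : ∀ l : Fin m, k ≤ (l : ℕ) → ((b : Mat p m) * M) l = 0) :
    ∑ s : GLm p m, ZMod.stdAddChar (Matrix.trace (M * (s : Mat p m))) * χ s⁻¹ = 0 := by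
  set S := ∑ s : GLm p m, ZMod.stdAddChar (Matrix.trace (M * (s : Mat p m))) * χ s⁻¹ with hS
  have key : ∀ h : H, S = ∑ t : GLm p m,
      ZMod.stdAddChar (Matrix.trace (M * (t : Mat p m))) * χ ((h : GLm p m) * (b * t⁻¹ * b⁻¹)) := by
    intro h
    have hN : (((h : GLm p m)⁻¹ : GLm p m) : Mat p m) * ((b : Mat p m) * M) = (b : Mat p m) * M := by
      ext l j
      rw [show ((b : Mat p m) * M) l j = ((1 : Mat p m) * ((b : Mat p m) * M)) l j by rw [Matrix.one_mul]]
      exact mul_apply_congr (fun i hi => congrFun (hb i hi) j) (fun i hi => hHk _ (H.inv_mem h.2) i l hi)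
    have huM : ((b⁻¹ * (h : GLm p m)⁻¹ * b : GLm p m) : Mat p m) * M = M := by
      rw [Units.val_mul, Units.val_mul, Matrix.mul_assoc, Matrix.mul_assoc, hN, Units.inv_mul_cancel_left]
    rw [hS]; refine (Fintype.sum_equiv (Equiv.mulRight (b⁻¹ * (h : GLm p m)⁻¹ * b)) _ _ fun t => ?_).symm
    simp only [Equiv.coe_mulRight]
    congr 1
    · rw [Units.val_mul, ← Matrix.mul_assoc, Matrix.trace_mul_cycle, huM]
    · calc χ ((h : GLm p m) * (b * t⁻¹ * b⁻¹))
            = χ ((h : GLm p m) * b * t⁻¹ * b⁻¹) := by congr 1; group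
        _ = χ (b⁻¹ * ((h : GLm p m) * b * t⁻¹)) := (hcl _ _).symm
        _ = χ (t * (b⁻¹ * (h : GLm p m)⁻¹ * b))⁻¹ := by congr 1; group
  have hcard : (Fintype.card H : ℂ) * S = 0 := by
    rw [← nsmul_eq_mul, ← Finset.card_univ, ← Finset.sum_const,
      Finset.sum_congr rfl fun h _ => key h, Finset.sum_comm]
    refine Finset.sum_eq_zero fun t _ => ?_
    rw [← Finset.mul_sum, hH, mul_zero]
  exact (mul_eq_zero.mp hcard).resolve_left (Nat.cast_ne_zero.mpr Fintype.card_ne_zero)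

/-- **Stub A's content.** For an irreducible `ρ` on `V` whose character lies in the level `F_k`, `V^{H_k} ≠ 0`:
otherwise all `H_k`-translates `Σ_h χ(h x)` vanish (`sum_char_mul_eq_zero`), every Fourier mode of rank `≤ k` is
orthogonal to `χ` (`mode_sum_eq_zero`), so `Σ_g χ(g) χ(g⁻¹) = 0`, contradicting `⟨χ, χ⟩ = 1`. [folklore] -/
theorem invariants_ne_bot [Fact p.Prime] {k : ℕ} (H : Subgroup (GLm p m))
    (hH : ∀ h : GLm p m, h ∈ H ↔ ∀ i j : Fin m, (i : ℕ) < k → (h : Mat p m) j i = (1 : Mat p m) j i)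
    {V : Type} [AddCommGroup V] [Module ℂ V] [FiniteDimensional ℂ V] (ρ : Representation ℂ (GLm p m) V)
    (hirr : IsIrrChar (GLm p m) ρ.character) {c : Mat p m → ℂ} (hc : RankSupp k c)
    (hχc : ∀ g, ρ.character g = fourierFn c g) : Representation.invariants (ρ.comp H.subtype) ≠ ⊥ := by
  classical
  intro hbot
  have hHx : ∀ x : GLm p m, ∑ h : H, ρ.character (h * x) = 0 := sum_char_mul_eq_zero ρ H hbot
  have hinner : ∑ s : GLm p m, ρ.character s * ρ.character s⁻¹ = 0 := by
    calc ∑ s : GLm p m, ρ.character s * ρ.character s⁻¹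
          = ∑ s : GLm p m, ∑ M : Mat p m,
              c M * (ZMod.stdAddChar (Matrix.trace (M * (s : Mat p m))) * ρ.character s⁻¹) := by
            refine Finset.sum_congr rfl fun s _ => ?_
            rw [hχc s]; simp only [fourierFn, Finset.sum_mul, mul_assoc]
        _ = ∑ M : Mat p m, c M * ∑ s : GLm p m,
              ZMod.stdAddChar (Matrix.trace (M * (s : Mat p m))) * ρ.character s⁻¹ := by
            rw [Finset.sum_comm]; simp only [Finset.mul_sum]
        _ = 0 := Finset.sum_eq_zero fun M _ => by
            by_cases hMk : k < M.rank
            · rw [hc M hMk, zero_mul]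
            · obtain ⟨b, hb⟩ := exists_mul_rows_eq_zero M (not_lt.mp hMk)
              rw [mode_sum_eq_zero ρ.character (fun x y => ρ.char_mul_comm y x) H
                (fun h hh => (hH h).mp hh) hHx hb, mul_zero]
  have h1 := IsIrrChar.classInner_eq hirr hirr
  rw [if_pos rfl, classInner_apply, hinner, mul_zero] at h1
  exact zero_ne_one h1

end SharpLevelDegree

open Module SharpLevelDegree in
/-- **Stub I `SharpLevelDegree`** (registered signature).  Green's degree bound for `GL_n(𝔽_p)` (the hypothesis)
implies, for `1 ≤ k ≤ m` and `χ = χ_ρ ∈ Irr(GL_m(𝔽_p)) ∩ F_k`, `χ(1) ≤ 2^{m+k} p^{mk - k²/2 - k/2}`: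
`V^{H_k} ≠ 0` (`invariants_ne_bot`) is stable under the block-diagonal `s(GL_k(𝔽_p))` (`exists_blockDiagHom`,
normalising `H_k`), so contains an irreducible `GL_k(𝔽_p)`-piece `W`, `dim W ≤ 2^k p^{k(k-1)/2}` (hypothesis);
`W` is stable under the subgroup `P ⊇ s(GL_k) H_k` of `g` with `ρ(g) W ⊆ W`, so `dim V ≤ [G:P] dim W`
(`finrank_le_index_mul`) with `[G:P] p^{k²} ≤ 2^k [G:P][P:H_k] = 2^k [G:H_k] ≤ 2^k p^{mk}`. -/
theorem stub_sharpLevelDegree :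
    (∀ (n p : ℕ) [Fact p.Prime], ∀ χ ∈ irrChars (GLm p n), (χ 1).re ≤ 2 ^ n * (p : ℝ) ^ ((n : ℝ) * (n - 1) / 2)) →
      ∀ (p m k : ℕ) [Fact p.Prime], 1 ≤ k → k ≤ m →
        ∀ χ ∈ irrChars (GLm p m) ∩ levelSet p m k,
          (χ 1).re ≤ 2 ^ (m + k) * (p : ℝ) ^ ((m : ℝ) * k - (k : ℝ) ^ 2 / 2 - (k : ℝ) / 2) := by
  intro hGreen p m k hp hk hkm χ hχ
  obtain ⟨hirr, c, hc, hχc⟩ := hχ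
  obtain ⟨V, _, _, _, ρ, hρ, rfl⟩ := id hirr
  classical
  obtain ⟨H, hH⟩ := exists_subgroup_of_mul_mem
    (fun h : GLm p m => ∀ i j : Fin m, (i : ℕ) < k → (h : Mat p m) j i = (1 : Mat p m) j i)
    (fun i j _ => by rw [Units.val_one]) fun a b ha hb i j hi => by
      rw [Units.val_mul, mul_apply_of_frame hb i j hi, ha i j hi]
  obtain ⟨s, hs⟩ := exists_blockDiagHom (p := p) hkm
  set VH : Submodule ℂ V := Representation.invariants (ρ.comp H.subtype) with hVH
  have hne : VH ≠ ⊥ := invariants_ne_bot H hH ρ hirr hc hχc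
  -- `s(A)` normalises `H`, so `V^H` is stable under `ρ(s A)`
  have hnorm : ∀ A, ∀ h ∈ H, (s A)⁻¹ * h * s A ∈ H := by
    intro A h hh
    rw [hH] at hh ⊢
    intro i j hi
    rw [Units.val_mul, Units.val_mul, mul_apply_congr (fun l hl => (hs A).1 i l hi hl)
      (fun l hl => mul_apply_of_frame hh l j hl), ← Units.val_mul, inv_mul_cancel, Units.val_one]
  have hstab : ∀ A, ∀ v ∈ VH, ρ (s A) v ∈ VH := by
    intro A v hv
    rw [hVH, Representation.mem_invariants] at hv ⊢
    intro h
    have hu : ρ ((s A)⁻¹ * h * s A) v = v := hv ⟨_, hnorm A h h.2⟩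
    change ρ (h : GLm p m) (ρ (s A) v) = ρ (s A) v
    rw [← Module.End.mul_apply, ← map_mul,
      show (h : GLm p m) * s A = s A * ((s A)⁻¹ * h * s A) by group, map_mul, Module.End.mul_apply, hu]
  -- an irreducible `GL_k(𝔽_p)`-piece `W ⊆ V^H` and Green's bound for it
  let θ : Representation ℂ (GL (Fin k) (ZMod p)) VH :=
    (⟨VH, fun A v hv => hstab A v hv⟩ : Subrepresentation (ρ.comp s)).toRepresentation
  haveI : Nontrivial VH := Submodule.nontrivial_iff_ne_bot.mpr hne
  obtain ⟨q, hq, hqirr⟩ := Representation.exists_ne_bot_isIrreducible θ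
  set W : Submodule ℂ V := q.toSubmodule.map VH.subtype with hW
  have hWne : W ≠ ⊥ := fun h0 => hq (Subrepresentation.toSubmodule_injective
    (Submodule.map_injective_of_injective VH.injective_subtype (h0.trans (Submodule.map_bot _).symm)))
  have hdW : (finrank ℂ W : ℝ) ≤ 2 ^ k * (p : ℝ) ^ ((k : ℝ) * (k - 1) / 2) := by
    have h := hGreen k p q.toRepresentation.character ⟨_, _, _, inferInstance, q.toRepresentation, hqirr, rfl⟩
    rwa [Representation.char_one, Complex.natCast_re, ← Submodule.finrank_map_subtype_eq VH q.toSubmodule]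
      at h
  -- the stabiliser `P` of `W`; it contains `H` and `s(GL_k)`
  obtain ⟨P, hP⟩ := exists_subgroup_of_mul_mem (fun g : GLm p m => ∀ w ∈ W, ρ g w ∈ W)
    (fun w hw => by rwa [map_one, Module.End.one_apply])
    (fun a b ha hb w hw => by rw [map_mul, Module.End.mul_apply]; exact ha _ (hb _ hw))
  have hHP : H ≤ P := fun h hh => (hP h).mpr fun w hw => by
    obtain ⟨v, hv, rfl⟩ := Submodule.mem_map.mp hw
    have hfix : ρ h (v : V) = v := (Representation.mem_invariants _ _).mp v.2 ⟨h, hh⟩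
    rw [Submodule.subtype_apply, hfix]
    exact Submodule.mem_map_of_mem hv
  have hsP : ∀ A, s A ∈ P := fun A => (hP _).mpr fun w hw => by
    obtain ⟨v, hv, rfl⟩ := Submodule.mem_map.mp hw
    exact Submodule.mem_map.mpr ⟨θ A v, q.apply_mem_toSubmodule A hv, rfl⟩
  -- orbit span and indices: `dim V ≤ [G:P] dim W`, `[G:H] ≤ p^{mk}`, `|GL_k(𝔽_p)| ≤ [P:H]`
  have h1 : finrank ℂ V ≤ P.index * finrank ℂ W :=
    finrank_le_index_mul ρ hρ P W hWne fun g hg => (hP g).mp hg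
  have hHidx : H.index ≤ p ^ (m * k) := by
    have h : H.index ≤ Nat.card (Fin k → Fin m → ZMod p) := by
      rw [Subgroup.index_eq_card]
      refine Nat.card_le_card_of_injective
        (fun q : GLm p m ⧸ H => fun (x : Fin k) (j : Fin m) => (q.out : Mat p m) j (Fin.castLE hkm x))
        fun a b hab => ?_
      rw [← QuotientGroup.out_eq' a, ← QuotientGroup.out_eq' b, QuotientGroup.eq, hH]
      intro i j hi
      rw [Units.val_mul, ← Units.inv_mul a.out, Matrix.mul_apply, Matrix.mul_apply]
      exact Finset.sum_congr rfl fun l _ => by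
        rw [show (b.out : Mat p m) l i = (a.out : Mat p m) l i from (congrFun (congrFun hab ⟨i, hi⟩) l).symm]
    rwa [Nat.card_fun, Nat.card_fun, Nat.card_zmod, Nat.card_fin, Nat.card_fin, ← pow_mul] at h
  have hGL : Nat.card (GL (Fin k) (ZMod p)) ≤ H.relIndex P := by
    rw [Subgroup.relIndex, Subgroup.index_eq_card]
    refine Nat.card_le_card_of_injective (fun A => ((⟨s A, hsP A⟩ : P) : P ⧸ H.subgroupOf P))
      fun A B hAB => ?_
    have h := QuotientGroup.eq.mp hAB
    rw [Subgroup.mem_subgroupOf, Subgroup.coe_mul, Subgroup.coe_inv, ← map_inv, ← map_mul, hH] at h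
    rw [← inv_mul_eq_one]
    refine Matrix.GeneralLinearGroup.ext fun x y => ?_
    rw [← (hs (A⁻¹ * B)).2 x y, h _ _ y.isLt, Units.val_one]
    simp [Matrix.one_apply]
  have hcard := card_pow_sq_le_card_GL (ZMod p) k
  rw [ZMod.card] at hcard
  have hidx : P.index * p ^ (k * k) ≤ 2 ^ k * p ^ (m * k) :=
    calc P.index * p ^ (k * k) ≤ P.index * (2 ^ k * H.relIndex P) :=
          Nat.mul_le_mul_left _ (hcard.trans (Nat.mul_le_mul_left _ hGL))
      _ = 2 ^ k * (H.relIndex P * P.index) := by ring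
      _ ≤ 2 ^ k * p ^ (m * k) := by
          rw [Subgroup.relIndex_mul_index hHP]; exact Nat.mul_le_mul_left _ hHidx
  -- real bookkeeping
  have hp0 : (0 : ℝ) < p := Nat.cast_pos.mpr hp.out.pos
  have hPi : (P.index : ℝ) ≤ 2 ^ k * (p : ℝ) ^ ((m : ℝ) * k - (k : ℝ) * k) := by
    rw [Real.rpow_sub hp0, ← mul_div_assoc, le_div_iff₀ (Real.rpow_pos_of_pos hp0 _)]
    have h := (Nat.cast_le (α := ℝ)).mpr hidx
    push_cast at h
    rwa [← Real.rpow_natCast (p : ℝ) (k * k), ← Real.rpow_natCast (p : ℝ) (m * k), Nat.cast_mul,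
      Nat.cast_mul] at h
  rw [ρ.char_one, Complex.natCast_re]
  calc (finrank ℂ V : ℝ) ≤ (P.index : ℝ) * (finrank ℂ W : ℝ) := by exact_mod_cast h1
    _ ≤ 2 ^ k * (p : ℝ) ^ ((m : ℝ) * k - (k : ℝ) * k) * (2 ^ k * (p : ℝ) ^ ((k : ℝ) * (k - 1) / 2)) :=
        mul_le_mul hPi hdW (Nat.cast_nonneg _) (by positivity)
    _ = 2 ^ (k + k) * (p : ℝ) ^ ((m : ℝ) * k - (k : ℝ) ^ 2 / 2 - (k : ℝ) / 2) := by
        rw [pow_add, mul_mul_mul_comm, ← Real.rpow_add hp0]; congr 2; ring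
    _ ≤ 2 ^ (m + k) * (p : ℝ) ^ ((m : ℝ) * k - (k : ℝ) ^ 2 / 2 - (k : ℝ) / 2) :=
        mul_le_mul_of_nonneg_right (pow_le_pow_right₀ (by norm_num) (by omega)) (by positivity)

end Summit.MatrixMultiplication.MatrixMultiplication.Theorems.LieRankDesigns

end
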